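import Summits.HodgeConjecture.HodgeConjecture.Theorems.LinearSystemTorelliLocalTubeSpanLemma11Nondegenerate

/-!
# Route LinearSystemTorelli — crux `LocalTubeSpan` (stmt-HodgeConjecture-2490): Schnell's Lemma 11 from the NONDEGENERATE case of Janssen's Theorem 2.5

Helper file (`--supports stmt-HodgeConjecture-2490`, line `Sketch` of the crux chain; cycle 10).
Schnell's Lemma 11 (nondegenerate) from the NONDEGENERATE CASE of Janssen's Theorem 2.5 and the
existence of star bases as hypotheses — the proof of
`localTubeSpan_schnell2010_lemma11_nondegenerate_of_starBasis`
(`LinearSystemTorelliLocalTubeSpanLemma11OfStarBasis`) verbatim, observing that its single appeal to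
Theorem 2.5 is made for the orbit lattice `Δ'` of a star basis inside the ambient NONDEGENERATE
space, so only the nondegenerate case of Theorem 2.5 is ever used (cycle 10: Theorem U⁺ proves that
case unconditionally, so this file makes Lemma 11 unconditional).

* `localTubeSpan_schnell2010_lemma11_nondegenerate_of_nondegenerate25` — the nondegenerate case of
  `Janssen1983_thm2_5` (hypothesis `h25nd`: Theorem 2.5 for skew vanishing lattices in a space
  carrying a NONDEGENERATE alternating form) and the existence, for every alternating form on a
  finite-dimensional `ℚ`-space and every skew vanishing lattice `Δ`, of a STAR basis inside `Δ`
  (`dim V` linearly independent members of `Δ`, all but the centre pairing to `1` with the centre)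
  imply `Schnell2010_lemma11_nondegenerate`.  The proof is that of [Schnell2010] §7, Lemma 11: the
  orbit `Δ' = Γ'·δ_•` of the star basis under `Γ' = Γ_{δ_•}` is a vanishing lattice with
  `Γ_{Δ'} = Γ'` (`localTubeSpan_starOrbit_isSkewVanishingLattice`), so by (nondegenerate)
  Theorem 2.5 `Γ'` contains `Sp♯₂(ℤδ_•)`, in particular the principal congruence elements
  `{g ∈ Γ_Δ | g ≡ 1 (mod c·ℤΔ)}`, `c = 2de`, which have finite index in `Γ_Δ`
  (`localTubeSpan_finiteIndex_of_congruence`);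
* `localTubeSpan_schnell2010_lemma11_of_nondegenerate25` — hence, by the frame lift through the
  radical (`localTubeSpan_schnell2010_lemma11_of_nondegenerate`), the GENERAL `Schnell2010_lemma11`.

No named fact is used (both arithmetic inputs are hypotheses); no `sorry`.
-/

-- `Summit.HodgeConjecture.HodgeConjecture.Theorems` is the mandated namespace (single-conjunct summit:
-- Sub = Summit), which `linter.dupNamespace` flags on every declaration; the lakefile turns the
-- linter off tree-wide (weak option), restated here so stand-alone elaboration is warning-free too.
set_option linter.dupNamespace false

noncomputable section

open Literature.AlgebraicGeometry.HodgeTheory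

namespace Summit.HodgeConjecture.HodgeConjecture.Theorems

/-- **Schnell's Lemma 11 for NONDEGENERATE lattices, from the nondegenerate case of Janssen's
Theorem 2.5 and star bases.**  For a nondegenerate alternating form on a finite-dimensional
`ℚ`-space and a skew vanishing lattice `Δ`, there are `dim V` linearly independent elements of `Δ`
whose transvection group `Γ'` has finite index in `Γ_Δ`, PROVIDED Theorem 2.5 holds for skew
vanishing lattices of NONDEGENERATE alternating forms (hypothesis `h25nd`) and every skew vanishing
lattice contains a star basis (hypothesis `hSB`): take a star basis, whose orbit lattice `Δ'` has
`Γ_{Δ'} = Γ'` (`localTubeSpan_starOrbit_isSkewVanishingLattice`); by Theorem 2.5 — applied to `Δ'`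
inside the ambient nondegenerate space — `Γ'` contains the congruence subgroup of `ℤΔ' = ℤδ_•`, in
particular every principal congruence element `g ≡ 1 (mod 2de·ℤΔ)` of `Γ_Δ` (`d·ℤΔ ⊆ ℤδ_•`, `e`
the dual exponent), and these have finite index (`localTubeSpan_finiteIndex_of_congruence`).
[cite: Schnell2010, §7 Lemma 11] -/
theorem localTubeSpan_schnell2010_lemma11_nondegenerate_of_nondegenerate25
    (h25nd : ∀ (W : Type) [AddCommGroup W] [Module ℚ W] [FiniteDimensional ℚ W]
      (Bq : LinearMap.BilinForm ℚ W), Bq.IsAlt → Bq.Nondegenerate → ∀ Δq : Set W,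
      IsSkewVanishingLattice Bq Δq → ∀ g : (W →ₗ[ℚ] W)ˣ,
        (∀ x y : W, Bq ((g : W →ₗ[ℚ] W) x) ((g : W →ₗ[ℚ] W) y) = Bq x y) →
        (∀ x ∈ Submodule.span ℤ Δq, (g : W →ₗ[ℚ] W) x ∈ Submodule.span ℤ Δq) →
        (∀ x ∈ Submodule.span ℤ Δq, ((g⁻¹ : (W →ₗ[ℚ] W)ˣ) : W →ₗ[ℚ] W) x ∈ Submodule.span ℤ Δq) →
        (∀ l : W →ₗ[ℚ] ℚ, (∀ x ∈ Submodule.span ℤ Δq, ∃ z : ℤ, l x = z) →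
          ∃ v ∈ Submodule.span ℤ Δq, ∀ x ∈ Submodule.span ℤ Δq,
            l ((g : W →ₗ[ℚ] W) x - x) = 2 * Bq v x) →
        g ∈ transvectionGroup Bq Δq)
    (hSB : ∀ (W : Type) [AddCommGroup W] [Module ℚ W] [FiniteDimensional ℚ W]
      (Bq : LinearMap.BilinForm ℚ W), Bq.IsAlt → ∀ Δq : Set W, IsSkewVanishingLattice Bq Δq →
        ∃ (r : ℕ) (δ : Fin r → W) (i₀ : Fin r), r = Module.finrank ℚ W ∧ (∀ i, δ i ∈ Δq) ∧
          LinearIndependent ℚ δ ∧ ∀ i, i ≠ i₀ → Bq (δ i) (δ i₀) = 1) :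
    Schnell2010_lemma11_nondegenerate := by
  intro V _ _ _ B hB hBnd Δ hΔ
  classical
  -- a star basis
  obtain ⟨r, δ, i₀, hr, hδΔ, hli, hstar⟩ := hSB V B hB Δ hΔ
  have hsp : Submodule.span ℚ (Set.range δ) = ⊤ := by
    apply Submodule.eq_top_of_finrank_eq
    rw [finrank_span_eq_card hli, Fintype.card_fin, hr]
  -- `r ≥ 2`: the pair `⟨δ₁, δ₂⟩ = 1` is linearly independent
  obtain ⟨i₁, hi₁⟩ : ∃ i₁ : Fin r, i₁ ≠ i₀ := by
    obtain ⟨a, ha, b, hb, hab⟩ := hΔ.exists_pair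
    have hab_li : LinearIndependent ℚ ![a, b] := by
      refine LinearIndependent.pair_iff.2 fun s t hst => ?_
      have h1 := congrArg (fun v => B v b) hst
      have h2 := congrArg (fun v => B v a) hst
      simp only [map_add, map_smul, LinearMap.add_apply, LinearMap.smul_apply, smul_eq_mul, hab,
        hB.self_eq_zero, map_zero, LinearMap.zero_apply, mul_one, mul_zero, add_zero, zero_add]
        at h1 h2
      rw [← hB.neg_eq, hab] at h2
      exact ⟨h1, by linarith⟩
    have h2r : 2 ≤ r := by
      have := hab_li.fintype_card_le_finrank
      rw [Fintype.card_fin, ← hr] at this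
      exact this
    haveI : Nontrivial (Fin r) := Fin.nontrivial_iff_two_le.2 h2r
    exact exists_ne i₀
  -- the orbit lattice `Δ'` of the star basis and its group `Γ'`
  set Γ : Subgroup (V →ₗ[ℚ] V)ˣ := transvectionGroup B Δ with hΓdef
  set Γ' : Subgroup (V →ₗ[ℚ] V)ˣ := transvectionGroup B (Set.range δ) with hΓ'def
  set Δ' : Set V := {x | ∃ g ∈ transvectionGroup B (Set.range δ), ∃ i,
    ((g : (V →ₗ[ℚ] V)ˣ) : V →ₗ[ℚ] V) (δ i) = x} with hΔ'def
  obtain ⟨hΔ'Δ, hspanZ, hΓeq, hΔ'⟩ := localTubeSpan_starOrbit_isSkewVanishingLattice B hB Δ hΔ δ hδΔ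
    hsp i₀ i₁ hi₁ hstar Δ' hΔ'def
  have hδsub : Set.range δ ⊆ Δ := by rintro _ ⟨i, rfl⟩; exact hδΔ i
  have hΓ'Γ : Γ' ≤ Γ := transvectionGroup_mono B hδsub
  -- the lattices `Λ = ℤΔ ⊇ Λ' = ℤδ`, the exponent `d` with `dΛ ⊆ Λ'`
  set Λ : Submodule ℤ V := Submodule.span ℤ Δ with hΛdef
  set Λ' : Submodule ℤ V := Submodule.span ℤ (Set.range δ) with hΛ'def
  have hΛ'Λ : Λ' ≤ Λ := Submodule.span_mono hδsub
  have hΛ'span : Submodule.span ℚ (Λ' : Set V) = ⊤ := by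
    rw [hΛ'def, Submodule.span_span_of_tower]; exact hsp
  obtain ⟨d, hdpos, hd⟩ := localTubeSpan_exists_uniform_nsmul_mem Λ Λ' hΔ.fg fun x _ =>
    localTubeSpan_exists_nsmul_mem_of_span_eq_top Λ' hΛ'span x
  -- the dual exponent `e` of the nondegenerate form on the basis `δ`
  obtain ⟨e, hepos, he⟩ := localTubeSpan_exists_dual_exponent B hBnd δ hli hsp
  -- `Γ` preserves `Λ`
  have hΓΛ : ∀ g ∈ Γ, ∀ x ∈ Λ, ((g : (V →ₗ[ℚ] V)ˣ) : V →ₗ[ℚ] V) x ∈ Λ := fun g hg x hx =>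
    localTubeSpan_transvectionGroup_map_span_int B hB Δ hΔ.integral hg hx
  -- the principal congruence elements of level `c = 2 d e` lie in `Γ'`, by (nondegenerate)
  -- Theorem 2.5 on `Δ'` inside the nondegenerate space `V`
  set c : ℕ := 2 * d * e with hcdef
  have hcpos : 0 < c := by positivity
  have hcong : ∀ g ∈ Γ, (∀ x ∈ Λ, ∃ y ∈ Λ, ((g : (V →ₗ[ℚ] V)ˣ) : V →ₗ[ℚ] V) x - x = (c : ℤ) • y) →
      g ∈ Γ' := by
    intro g hg hgc
    -- the same congruence for `g⁻¹`
    have hgc' : ∀ x ∈ Λ, ∃ y ∈ Λ, ((g⁻¹ : (V →ₗ[ℚ] V)ˣ) : V →ₗ[ℚ] V) x - x = (c : ℤ) • y := by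
      intro x hx
      have hx' : ((g⁻¹ : (V →ₗ[ℚ] V)ˣ) : V →ₗ[ℚ] V) x ∈ Λ := hΓΛ _ (Γ.inv_mem hg) x hx
      obtain ⟨y, hy, hyeq⟩ := hgc _ hx'
      rw [localTubeSpan_units_apply_inv_apply] at hyeq
      refine ⟨-y, Λ.neg_mem hy, ?_⟩
      rw [smul_neg, ← hyeq]; abel
    -- `cΛ ⊆ Λ'`, so `g^{±1}` preserve `Λ' = ℤΔ'`
    have hcΛ : ∀ y ∈ Λ, (c : ℤ) • y ∈ Λ' := fun y hy => by
      rw [hcdef, show ((2 * d * e : ℕ) : ℤ) = (2 * e : ℤ) * d by push_cast; ring, mul_smul]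
      exact Λ'.smul_mem _ (hd y hy)
    have hpres : ∀ u : (V →ₗ[ℚ] V)ˣ,
        (∀ x ∈ Λ, ∃ y ∈ Λ, (u : V →ₗ[ℚ] V) x - x = (c : ℤ) • y) →
          ∀ x ∈ Submodule.span ℤ Δ', (u : V →ₗ[ℚ] V) x ∈ Submodule.span ℤ Δ' := by
      intro u hu x hx
      rw [hspanZ] at hx ⊢
      obtain ⟨y, hy, hyeq⟩ := hu x (hΛ'Λ hx)
      rw [show (u : V →ₗ[ℚ] V) x = x + (c : ℤ) • y by rw [← hyeq]; abel]
      exact Λ'.add_mem hx (hcΛ y hy)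
    -- the `Sp♯₂` condition: `l (g x - x) = 2 B(v, x)` on `Λ' = ℤΔ'`
    have hsp2 : ∀ l : V →ₗ[ℚ] ℚ, (∀ x ∈ Submodule.span ℤ Δ', ∃ z : ℤ, l x = z) →
        ∃ v ∈ Submodule.span ℤ Δ', ∀ x ∈ Submodule.span ℤ Δ',
          l (((g : (V →ₗ[ℚ] V)ˣ) : V →ₗ[ℚ] V) x - x) = 2 * B v x := by
      intro l hl
      rw [hspanZ] at hl ⊢
      -- the auxiliary functional `l'' x = l ((d/c) (g x - x))`, integral on the basis
      let φ : V →ₗ[ℚ] V := ((g : (V →ₗ[ℚ] V)ˣ) : V →ₗ[ℚ] V) - LinearMap.id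
      let l'' : V →ₗ[ℚ] ℚ := l ∘ₗ (((d : ℚ) / c) • φ)
      have hl''apply : ∀ x, l'' x =
          l (((d : ℚ) / c) • (((g : (V →ₗ[ℚ] V)ˣ) : V →ₗ[ℚ] V) x - x)) := fun x => rfl
      have hl''int : ∀ i, ∃ z : ℤ, l'' (δ i) = z := by
        intro i
        obtain ⟨y, hy, hyeq⟩ := hgc (δ i) (hΛ'Λ (Submodule.subset_span ⟨i, rfl⟩))
        have hdy : (d : ℤ) • y ∈ Λ' := hd y hy
        obtain ⟨z, hz⟩ := hl _ hdy
        refine ⟨z, ?_⟩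
        rw [hl''apply, hyeq, ← hz]
        congr 1
        rw [← Int.cast_smul_eq_zsmul ℚ (c : ℤ), ← Int.cast_smul_eq_zsmul ℚ (d : ℤ), smul_smul,
          Int.cast_natCast, Int.cast_natCast, div_mul_cancel₀ _ (by exact_mod_cast hcpos.ne')]
      obtain ⟨v₀, hv₀, hv₀eq⟩ := he l'' hl''int
      refine ⟨v₀, hv₀, fun x _ => ?_⟩
      have hd0 : (d : ℚ) ≠ 0 := by exact_mod_cast hdpos.ne'
      have hc0 : (c : ℚ) ≠ 0 := by exact_mod_cast hcpos.ne'
      have e1 : l (((g : (V →ₗ[ℚ] V)ˣ) : V →ₗ[ℚ] V) x - x) = ((c : ℚ) / d) * l'' x := by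
        rw [hl''apply, map_smul, smul_eq_mul, ← mul_assoc,
          show (c : ℚ) / d * ((d : ℚ) / c) = 1 by field_simp, one_mul]
      rw [e1, ← hv₀eq x, hcdef]
      push_cast
      field_simp
    have key := h25nd V B hB hBnd Δ' hΔ' g (localTubeSpan_transvectionGroup_isometry B hB Δ hg)
      (hpres g hgc) (hpres g⁻¹ hgc') hsp2
    rw [hΓeq] at key
    exact key
  -- finite index of `Γ'` in `Γ` by the congruence subgroup lemma
  have hfi : (Γ'.subgroupOf Γ).FiniteIndex :=
    localTubeSpan_finiteIndex_of_congruence Γ Λ hΔ.fg hΓΛ c hcpos Γ' hcong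
  exact ⟨r, δ, hr, hδΔ, hli, hfi⟩

/-- **Schnell's Lemma 11 (all alternating forms) from the nondegenerate case of Janssen's
Theorem 2.5 and star bases** — the nondegenerate case
(`localTubeSpan_schnell2010_lemma11_nondegenerate_of_nondegenerate25`) lifted through the radical by
the frame lift (`localTubeSpan_schnell2010_lemma11_of_nondegenerate`).  So, once star bases and the
nondegenerate case of Theorem 2.5 are proved (cycle 10, Theorem U⁺), Schnell's Lemma 11 is
unconditional. [cite: Schnell2010, §7 Lemma 11] -/
theorem localTubeSpan_schnell2010_lemma11_of_nondegenerate25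
    (h25nd : ∀ (W : Type) [AddCommGroup W] [Module ℚ W] [FiniteDimensional ℚ W]
      (Bq : LinearMap.BilinForm ℚ W), Bq.IsAlt → Bq.Nondegenerate → ∀ Δq : Set W,
      IsSkewVanishingLattice Bq Δq → ∀ g : (W →ₗ[ℚ] W)ˣ,
        (∀ x y : W, Bq ((g : W →ₗ[ℚ] W) x) ((g : W →ₗ[ℚ] W) y) = Bq x y) →
        (∀ x ∈ Submodule.span ℤ Δq, (g : W →ₗ[ℚ] W) x ∈ Submodule.span ℤ Δq) →
        (∀ x ∈ Submodule.span ℤ Δq, ((g⁻¹ : (W →ₗ[ℚ] W)ˣ) : W →ₗ[ℚ] W) x ∈ Submodule.span ℤ Δq) →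
        (∀ l : W →ₗ[ℚ] ℚ, (∀ x ∈ Submodule.span ℤ Δq, ∃ z : ℤ, l x = z) →
          ∃ v ∈ Submodule.span ℤ Δq, ∀ x ∈ Submodule.span ℤ Δq,
            l ((g : W →ₗ[ℚ] W) x - x) = 2 * Bq v x) →
        g ∈ transvectionGroup Bq Δq)
    (hSB : ∀ (W : Type) [AddCommGroup W] [Module ℚ W] [FiniteDimensional ℚ W]
      (Bq : LinearMap.BilinForm ℚ W), Bq.IsAlt → ∀ Δq : Set W, IsSkewVanishingLattice Bq Δq →
        ∃ (r : ℕ) (δ : Fin r → W) (i₀ : Fin r), r = Module.finrank ℚ W ∧ (∀ i, δ i ∈ Δq) ∧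
          LinearIndependent ℚ δ ∧ ∀ i, i ≠ i₀ → Bq (δ i) (δ i₀) = 1) :
    Schnell2010_lemma11 :=
  localTubeSpan_schnell2010_lemma11_of_nondegenerate fun W _ _ _ Bq hBq hnd Δq hΔq =>
    localTubeSpan_schnell2010_lemma11_nondegenerate_of_nondegenerate25 h25nd hSB W Bq hBq hnd Δq hΔq

end Summit.HodgeConjecture.HodgeConjecture.Theorems

end
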